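import Literature.NumberTheory.Sieve.TwistedWeightSmoothSum
import Literature.NumberTheory.Sieve.SmoothSaddleKernel
import HarnessLib

/-!
# The twisted saddle point: `∑_{n ∈ S(x,y)} w(n/x) e(λn/x)` on the principal major arc

Topic `Literature/NumberTheory/Sieve`; a PROVED file toward
`Literature.NumberTheory.DiophantineGeometry.XYZUpperHalf` ([Harper2016, Cor. 1], smoothed major
arc `q = 1`). With `W_λ(v) = v²(1−v)²e(λv)`, `α = α(x,y)`, `φ = φ₂(α,y)`, `e(t)` the saddle exponent
(`exp e(t) = ζ(α+it,y)x^{it}/ζ(α,y)`) and `f_λ(t) = exp(e(t)) Ŵ_λ(α+it)`,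

`S_w(λ) := ∑_{n ≤ x, n ∈ S(y)} W_λ(n/x) = (x^α ζ(α,y)/(2π)) ∫ f_λ(t) dt`   (`twistedSum_eq_integral`),

and more generally, for a scale `x/e` (`e ≥ 1`, SAME line `Re s = α = α(x,y)`),
`S_w(λ; x/e) = ∑_{n ∈ S(x/e,y)} W_λ(n/(x/e)) = (x^α ζ(α,y)/(2π)) ∫ f_{λ,e}` (`scaledSum_eq_integral`)
where `f_{λ,e}` is the kernel integrand of `SmoothSaddleKernel` for the kernel
`A_{λ,e}(t) = e^{−(α+it)} Ŵ_λ(α+it)`, with `B₀ = 2e^{−α}/(1+|λ|)`, `B₁ = (2 + 2 log e)e^{−α}/(1+|λ|)`,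
`B_a = e^{−α}`, `B₃ = e^{−α} C_λ`, `C_λ = 2 + 6(2π|λ|) + 6(2π|λ|)² + (2π|λ|)³` (`TwistedWeightMellin`),
whence the parametric major-arc estimate `norm_scaledSum_sub_main_le_param` for
`‖S_w(λ; x/e) − e^{−α} 𝓜 Ŵ_λ(α)‖`, `𝓜 = x^αζ(α,y)/√(2πφ)` (the main terms at the scales `x/e` are
EXACTLY `e^{−α}` times the one at `x`, which is what makes the local factors at `a/q` multiplicative);
the range `(log x)^4 ≤ y ≤ exp((log x)^{1/5})` is treated in `SmoothTwistedSaddleRange`.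

## References

* A. J. Harper, Compositio Math. 152 (2016), §5 [Harper2016].
* A. Hildebrand, G. Tenenbaum, Trans. AMS 296 (1986), §4 (Lemmas 10–11) [HildebrandTenenbaum1986].
-/

noncomputable section

open Real Complex MeasureTheory Set Filter
open scoped FourierTransform Topology

namespace Literature.NumberTheory.Sieve

namespace TwistedWeight

/-! ### The twisted integrand and the basic identity -/

/-- The scaled twisted kernel along `Re s = α`: `A_{λ,e}(t) = e^{−(α+it)} Ŵ_λ(α + it)`. [folklore] -/
def scaledKernel (α : ℝ) (e : ℕ) (lam : ℝ) (t : ℝ) : ℂ :=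
  (e : ℂ) ^ (-((α : ℂ) + t * I)) * twistMellin lam (α + t * I)

/-- `f_{λ,e}(t) = exp(e(t)) e^{−(α+it)} Ŵ_λ(α + it)`. [cite: HildebrandTenenbaum1986, §4 (4.3)] -/
def scaledIntegrand (x α : ℝ) (y e : ℕ) (lam : ℝ) (t : ℝ) : ℂ :=
  SaddleKernel.kernelIntegrand x α y (scaledKernel α e lam) t

/-- `‖e^{−(α+it)}‖ = e^{−α}` (`e ≥ 1`). [folklore] -/
theorem norm_natCast_cpow_neg {e : ℕ} (he : 0 < e) (α t : ℝ) :
    ‖(e : ℂ) ^ (-((α : ℂ) + t * I))‖ = (e : ℝ) ^ (-α) := by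
  rw [Complex.norm_natCast_cpow_of_pos he]; simp

/-- **`S_w(λ; x/e) = (x^α ζ(α,y)/(2π)) ∫ f_{λ,e}`** for `x > 0`, `e ≥ 1`, `α > 0` (Mellin inversion at
the scale `x/e` on the line `Re s = α`: `(x/e)^s = x^s e^{−s}`).
[cite: HildebrandTenenbaum1986, §4 (4.3)] [cite: Harper2016, §5] -/
theorem scaledSum_eq_integral {x α : ℝ} (hx : 0 < x) (hα : 0 < α) (y : ℕ) {e : ℕ} (he : 0 < e) (lam : ℝ) :
    ∑ n ∈ Nat.smoothNumbersUpTo ⌊x / e⌋₊ (y + 1), twistWeight lam (n / (x / e)) =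
      (((x ^ α * smoothZeta α y / (2 * π) : ℝ)) : ℂ) * ∫ t : ℝ, scaledIntegrand x α y e lam t := by
  have he0 : (0 : ℝ) < e := by exact_mod_cast he
  have hxe : 0 < x / e := div_pos hx he0
  rw [sum_twistWeight_eq_integral hxe hα y lam]
  have hpt : ∀ t : ℝ, (((x / e : ℝ)) : ℂ) ^ ((α : ℂ) + t * I) * twistMellin lam (α + t * I) *
      smoothZetaC ((α : ℂ) + t * I) y =
      (((x ^ α * smoothZeta α y : ℝ)) : ℂ) * scaledIntegrand x α y e lam t := by
    intro t
    rw [scaledIntegrand, SaddleKernel.kernelIntegrand, scaledKernel, exp_saddleExponent hα x y t]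
    have hζ : ((smoothZeta α y : ℝ) : ℂ) ≠ 0 := by exact_mod_cast (smoothZeta_pos hα).ne'
    -- `(x/e)^s = x^α e^{it log x} e^{-s}`
    have hx0' : (x : ℂ) ≠ 0 := by exact_mod_cast hx.ne'
    have he0' : (e : ℂ) ≠ 0 := by exact_mod_cast he.ne'
    have hxpow : (((x / e : ℝ)) : ℂ) ^ ((α : ℂ) + t * I) =
        (((x ^ α : ℝ)) : ℂ) * Complex.exp ((t * Real.log x : ℝ) * I) * (e : ℂ) ^ (-((α : ℂ) + t * I)) := by
      have h1 : (((x / e : ℝ)) : ℂ) = (x : ℂ) * ((((e : ℝ)⁻¹ : ℝ)) : ℂ) := by push_cast; ring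
      rw [h1, Complex.mul_cpow_ofReal_nonneg hx.le (by positivity : (0:ℝ) ≤ (e : ℝ)⁻¹)]
      push_cast
      rw [Complex.inv_cpow _ _ (by rw [Complex.natCast_arg]; exact Real.pi_ne_zero.symm), ← Complex.cpow_neg,
        Complex.cpow_add _ _ hx0', ← Complex.ofReal_cpow hx.le]
      congr 2
      rw [Complex.cpow_def_of_ne_zero hx0', ← Complex.ofReal_log hx.le]
      congr 1; ring
    rw [hxpow]
    push_cast
    field_simp
  rw [integral_congr_ae (Filter.Eventually.of_forall hpt), integral_const_mul]
  rw [Complex.real_smul]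
  push_cast
  ring

/-! ### The kernel hypotheses for `A_λ` -/

/-- `‖Ŵ_λ(α + it)‖ ≤ 2/(1 + |λ|)` for `|t| ≤ 3`, `0 < α ≤ 1`. [folklore] -/
theorem norm_twistMellin_le_two_div {α : ℝ} (hα : 0 < α) (hα1 : α ≤ 1) {t : ℝ} (ht : |t| ≤ 3) (lam : ℝ) :
    ‖twistMellin lam (α + t * I)‖ ≤ 2 / (1 + |lam|) := by
  have hs : 0 < ((α : ℂ) + t * I).re := by simp [hα]
  have h1 : ‖twistMellin lam (α + t * I)‖ ≤ 1 := norm_twistMellin_le_one hs.le lam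
  rcases le_or_gt |lam| 1 with hsmall | hbig
  · refine h1.trans ?_
    rw [le_div_iff₀ (by positivity)]; nlinarith [abs_nonneg lam]
  · have hlam : lam ≠ 0 := by intro h; rw [h, abs_zero] at hbig; linarith
    have h2 := norm_twistMellin_le_div hs hlam
    have hs1 : ‖(α : ℂ) + t * I + 1‖ ≤ 4 := by
      have : ‖(α : ℂ) + t * I + 1‖ ^ 2 = (α + 1) ^ 2 + t ^ 2 := by
        rw [Complex.sq_norm, Complex.normSq_apply]; simp; ring
      have h3 : (α + 1) ^ 2 + t ^ 2 ≤ 4 ^ 2 := by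
        have := abs_le.mp ht; nlinarith
      exact (pow_le_pow_iff_left₀ (norm_nonneg _) (by norm_num) two_ne_zero).1 (this ▸ h3)
    have hπ := Real.pi_gt_three
    refine h2.trans ?_
    rw [div_le_div_iff₀ (by positivity) (by positivity)]
    nlinarith [abs_nonneg lam]

/-- `‖e^{−it log e'} − 1‖ ≤ |t| log e'` for `e' ≥ 1`. [folklore] -/
theorem norm_natCast_cpow_neg_mul_I_sub_one_le {e : ℕ} (he : 1 ≤ e) (t : ℝ) :
    ‖(e : ℂ) ^ (-((t : ℂ) * I)) - 1‖ ≤ |t| * Real.log e := by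
  have he0 : (0 : ℝ) < e := by exact_mod_cast he
  have hlog : 0 ≤ Real.log e := Real.log_nonneg (by exact_mod_cast he)
  have h1 : (e : ℂ) ^ (-((t : ℂ) * I)) = Complex.exp (I * ((-(t * Real.log e) : ℝ) : ℂ)) := by
    rw [Complex.cpow_def_of_ne_zero (by exact_mod_cast he0.ne'), ← Complex.ofReal_natCast,
      ← Complex.ofReal_log he0.le]
    congr 1; push_cast; ring
  rw [h1]
  refine (Real.norm_exp_I_mul_ofReal_sub_one_le (x := -(t * Real.log e))).trans (le_of_eq ?_)
  rw [Real.norm_eq_abs, abs_neg, abs_mul, abs_of_nonneg hlog]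

/-- `A_{λ,e}` is continuous (`α > 0`, `e ≥ 1`). [folklore] -/
theorem continuous_scaledKernel {α : ℝ} (hα : 0 < α) {e : ℕ} (he : 0 < e) (lam : ℝ) :
    Continuous (scaledKernel α e lam) := by
  unfold scaledKernel
  refine Continuous.mul ?_ (continuous_twistMellin_vertical hα lam)
  have he0 : (e : ℂ) ≠ 0 := by exact_mod_cast he.ne'
  have : (fun t : ℝ => (e : ℂ) ^ (-((α : ℂ) + t * I))) = fun t : ℝ => Complex.exp (Complex.log e * (-((α : ℂ) + t * I))) := by
    funext t; rw [Complex.cpow_def_of_ne_zero he0]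
  rw [this]; fun_prop

/-- `‖A_{λ,e}(t)‖ = e^{−α} ‖Ŵ_λ(α+it)‖`. [folklore] -/
theorem norm_scaledKernel {α : ℝ} {e : ℕ} (he : 0 < e) (lam t : ℝ) :
    ‖scaledKernel α e lam t‖ = (e : ℝ) ^ (-α) * ‖twistMellin lam (α + t * I)‖ := by
  rw [scaledKernel, norm_mul, norm_natCast_cpow_neg he]

/-- `A_{λ,e}` is integrable (`α > 0`, `e ≥ 1`). [folklore] -/
theorem integrable_scaledKernel {α : ℝ} (hα : 0 < α) {e : ℕ} (he : 0 < e) (lam : ℝ) :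
    Integrable (scaledKernel α e lam) := by
  refine ((integrable_twistMellin_vertical hα lam).norm.const_mul ((e : ℝ) ^ (-α))).mono'
    (continuous_scaledKernel hα he lam).aestronglyMeasurable (Eventually.of_forall fun t => ?_)
  rw [norm_scaledKernel he]

/-- `f_{λ,e}` is integrable. [folklore] -/
theorem integrable_scaledIntegrand {α : ℝ} (hα : 0 < α) (x : ℝ) (y : ℕ) {e : ℕ} (he : 0 < e) (lam : ℝ) :
    Integrable (scaledIntegrand x α y e lam) :=
  SaddleKernel.integrable_kernelIntegrand hα x y (continuous_scaledKernel hα he lam) (integrable_scaledKernel hα he lam)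

set_option maxHeartbeats 1000000 in
/-- **The twisted saddle point at the scale `x/e`, parametric form.** With `𝓜 = x^α ζ(α,y)/√(2πφ)`,
`α = α(x,y)`, `φ = φ₂(α,y)`, under the range hypotheses (window `τ = 100/√φ ≤ π/log y ≤ 1`,
`13τ³ log y φ ≤ 1`) and the decay of `ζ(α+it,y)/ζ(α,y)` (`≤ ε₁` on `π/log y ≤ |t| ≤ 3`, `≤ ε₂` on
`3 ≤ |t| ≤ T`): `‖S_w(λ; x/e) − e^{−α} 𝓜 Ŵ_λ(α)‖ ≤ (x^α ζ(α,y)/(2π)) e^{−α} · E`, where `E` collects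
the window, Gaussian-completion and tail errors of `SaddleKernel.norm_kernelIntegral_sub_main_le`.
[cite: HildebrandTenenbaum1986, §4 (Lemmas 10–11)] [cite: Harper2016, §5] -/
theorem norm_scaledSum_sub_main_le_param {x T ε₁ ε₂ : ℝ} {y : ℕ} (hx : 1 < x) (hy : 2 ≤ y)
    (hα : 3 / 5 ≤ saddlePoint x y) (hα1 : saddlePoint x y ≤ 1) (hφ0 : 0 < saddlePhi₂ (saddlePoint x y) y)
    (hτ : 100 / Real.sqrt (saddlePhi₂ (saddlePoint x y) y) ≤ Real.pi / Real.log y)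
    (hy1 : Real.pi / Real.log y ≤ 1)
    (hη : 13 * (100 / Real.sqrt (saddlePhi₂ (saddlePoint x y) y)) ^ 3 * Real.log y *
      saddlePhi₂ (saddlePoint x y) y ≤ 1)
    (hT : 3 ≤ T) (hε₁ : 0 ≤ ε₁) (hε₂ : 0 ≤ ε₂)
    (hdec1 : ∀ t : ℝ, Real.pi / Real.log y ≤ |t| → |t| ≤ 3 →
      ‖smoothZetaC ((saddlePoint x y : ℂ) + t * I) y‖ / smoothZeta (saddlePoint x y) y ≤ ε₁)
    (hdec2 : ∀ t : ℝ, 3 ≤ |t| → |t| ≤ T →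
      ‖smoothZetaC ((saddlePoint x y : ℂ) + t * I) y‖ / smoothZeta (saddlePoint x y) y ≤ ε₂)
    {e : ℕ} (he : 1 ≤ e) (lam : ℝ) :
    ‖(∑ n ∈ Nat.smoothNumbersUpTo ⌊x / e⌋₊ (y + 1), twistWeight lam (n / (x / e))) -
        ((((e : ℝ) ^ (-saddlePoint x y) * (x ^ saddlePoint x y * smoothZeta (saddlePoint x y) y /
            Real.sqrt (2 * Real.pi * saddlePhi₂ (saddlePoint x y) y)) : ℝ)) : ℂ) * twistMellin lam (saddlePoint x y)‖ ≤
      (x ^ saddlePoint x y * smoothZeta (saddlePoint x y) y / (2 * Real.pi)) * (e : ℝ) ^ (-saddlePoint x y) *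
        ((2950 * Real.log y + 8 + 8 * Real.log e) / (saddlePhi₂ (saddlePoint x y) y * (1 + |lam|)) +
          2 / (1 + |lam|) * (Real.exp (-(saddlePhi₂ (saddlePoint x y) y / 4) *
              (100 / Real.sqrt (saddlePhi₂ (saddlePoint x y) y)) ^ 2) *
            Real.sqrt (4 * Real.pi / saddlePhi₂ (saddlePoint x y) y)) +
          ((2 / (1 + |lam|)) * Real.exp (-72) * Real.sqrt (125 * Real.pi ^ 3 / saddlePhi₂ (saddlePoint x y) y) +
            20 * Real.pi * ε₁ / (saddlePoint x y * (1 + |lam|)) + 2 * Real.pi * ε₂ * T +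
            2 * Real.pi * (2 + 6 * (2 * π * |lam|) + 6 * (2 * π * |lam|) ^ 2 + (2 * π * |lam|) ^ 3) / T ^ 2)) := by
  set α : ℝ := saddlePoint x y with hαdef
  have hα0 : 0 < α := by linarith
  set φ : ℝ := saddlePhi₂ α y with hφ
  have hx0 : 0 < x := by linarith
  have he0 : 0 < e := he
  have he0' : (0 : ℝ) < e := by exact_mod_cast he0
  have hloge : 0 ≤ Real.log e := Real.log_nonneg (by exact_mod_cast he)
  have hlogy2 : Real.log 2 ≤ Real.log y := Real.log_le_log two_pos (by exact_mod_cast hy)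
  have hlog2 : (0.6931471803 : ℝ) < Real.log 2 := Real.log_two_gt_d9
  set c : ℝ := x ^ α * smoothZeta α y / (2 * Real.pi) with hc
  have hc0 : 0 < c := by have := smoothZeta_pos (y := y) hα0; have := Real.pi_pos; positivity
  set ρ : ℝ := (e : ℝ) ^ (-α) with hρ
  have hρ0 : 0 < ρ := Real.rpow_pos_of_pos he0' _
  have hρ1 : ρ ≤ 1 := Real.rpow_le_one_of_one_le_of_nonpos (by exact_mod_cast he) (by linarith)
  -- the kernel constants
  set b₀ : ℝ := 2 * ρ / (1 + |lam|) with hb₀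
  have hb₀0 : 0 ≤ b₀ := by positivity
  set b₁ : ℝ := (2 + 2 * Real.log e) * ρ / (1 + |lam|) with hb₁
  have hb₁0 : 0 ≤ b₁ := by positivity
  set Cl : ℝ := 2 + 6 * (2 * π * |lam|) + 6 * (2 * π * |lam|) ^ 2 + (2 * π * |lam|) ^ 3 with hCl
  have hCl0 : 0 ≤ Cl := by have := Real.pi_pos; positivity
  have hB0 : ∀ t : ℝ, |t| ≤ 3 → ‖scaledKernel α e lam t‖ ≤ b₀ := by
    intro t ht
    rw [norm_scaledKernel he0, hb₀, ← hρ]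
    calc ρ * ‖twistMellin lam (α + t * I)‖ ≤ ρ * (2 / (1 + |lam|)) :=
          mul_le_mul_of_nonneg_left (norm_twistMellin_le_two_div hα0 hα1 ht lam) hρ0.le
      _ = 2 * ρ / (1 + |lam|) := by ring
  have hB1 : ∀ t : ℝ, |t| ≤ 1 → ‖scaledKernel α e lam t - scaledKernel α e lam 0‖ ≤ b₁ * |t| := by
    intro t ht
    have hW3 : ‖twistMellin lam (α + t * I)‖ ≤ 2 / (1 + |lam|) :=
      norm_twistMellin_le_two_div hα0 hα1 (ht.trans (by norm_num)) lam
    have hvar := norm_twistMellin_sub_le (σ := α) (by linarith) t lam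
    have hph := norm_natCast_cpow_neg_mul_I_sub_one_le he t
    -- `A(t) − A(0) = e^{-α}[(e^{-it} − 1) Ŵ(α+it) + (Ŵ(α+it) − Ŵ(α))]`
    have he0c : (e : ℂ) ≠ 0 := by exact_mod_cast he0.ne'
    have hsplit : (e : ℂ) ^ (-((α : ℂ) + t * I)) = (e : ℂ) ^ (-(α : ℂ)) * (e : ℂ) ^ (-((t : ℂ) * I)) := by
      rw [neg_add, Complex.cpow_add _ _ he0c]
    have hdec : scaledKernel α e lam t - scaledKernel α e lam 0 =
        (e : ℂ) ^ (-(α : ℂ)) * (((e : ℂ) ^ (-((t : ℂ) * I)) - 1) * twistMellin lam (α + t * I) +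
          (twistMellin lam (α + t * I) - twistMellin lam α)) := by
      simp only [scaledKernel]
      rw [hsplit]
      push_cast
      rw [zero_mul, add_zero]
      ring
    have hρC : ‖(e : ℂ) ^ (-(α : ℂ))‖ = ρ := by
      rw [hρ, Complex.norm_natCast_cpow_of_pos he0]; simp
    rw [hdec, norm_mul, hρC, hb₁]
    calc ρ * ‖((e : ℂ) ^ (-((t : ℂ) * I)) - 1) * twistMellin lam (α + t * I) +
          (twistMellin lam (α + t * I) - twistMellin lam α)‖
        ≤ ρ * (‖(e : ℂ) ^ (-((t : ℂ) * I)) - 1‖ * ‖twistMellin lam (α + t * I)‖ +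
            ‖twistMellin lam (α + t * I) - twistMellin lam α‖) := by
          apply mul_le_mul_of_nonneg_left _ hρ0.le
          rw [← norm_mul]; exact norm_add_le _ _
      _ ≤ ρ * ((|t| * Real.log e) * (2 / (1 + |lam|)) + 2 * |t| / (1 + |lam|)) := by
          apply mul_le_mul_of_nonneg_left _ hρ0.le
          exact add_le_add (mul_le_mul hph hW3 (norm_nonneg _) (by positivity)) hvar
      _ = (2 + 2 * Real.log e) * ρ / (1 + |lam|) * |t| := by ring
  have hBall : ∀ t : ℝ, ‖scaledKernel α e lam t‖ ≤ ρ := by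
    intro t
    rw [norm_scaledKernel he0, ← hρ]
    calc ρ * ‖twistMellin lam (α + t * I)‖ ≤ ρ * 1 :=
          mul_le_mul_of_nonneg_left (norm_twistMellin_le_one (by simp; exact hα0.le) lam) hρ0.le
      _ = ρ := mul_one _
  have hB3 : ∀ t : ℝ, T < |t| → ‖scaledKernel α e lam t‖ ≤ ρ * Cl / |t| ^ 3 := by
    intro t ht
    have hs : 0 < ((α : ℂ) + t * I).re := by simp; exact hα0
    have hW := norm_twistMellin_le_decay hs lam
    rw [← hCl] at hW
    have hge : ∀ k : ℝ, |t| ≤ ‖(α : ℂ) + t * I + k‖ := by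
      intro k
      have : |((α : ℂ) + t * I + k).im| ≤ ‖(α : ℂ) + t * I + k‖ := Complex.abs_im_le_norm _
      simpa using this
    have hprod : |t| ^ 3 ≤ ‖(α : ℂ) + t * I + 2‖ * ‖(α : ℂ) + t * I + 3‖ * ‖(α : ℂ) + t * I + 4‖ := by
      have h2 := hge 2; have h3 := hge 3; have h4 := hge 4
      push_cast at h2 h3 h4
      calc |t| ^ 3 = |t| * |t| * |t| := by ring
        _ ≤ _ := by
          apply mul_le_mul (mul_le_mul h2 h3 (abs_nonneg _) (norm_nonneg _)) h4 (abs_nonneg _) (by positivity)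
    have habs0 : 0 < |t| := lt_of_le_of_lt (by linarith) ht
    rw [norm_scaledKernel he0, ← hρ, mul_div_assoc]
    exact mul_le_mul_of_nonneg_left (hW.trans (div_le_div_of_nonneg_left hCl0 (by positivity) hprod)) hρ0.le
  have hK := SaddleKernel.norm_kernelIntegral_sub_main_le hx hy hα hα1 hφ0 hτ hy1 hη hT hε₁ hε₂ hdec1 hdec2
    (continuous_scaledKernel hα0 he0 lam) (integrable_scaledKernel hα0 he0 lam) hb₀0 hb₁0 hρ0.le (by positivity)
    hB0 hB1 hBall hB3
  rw [← hαdef, ← hφ] at hK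
  -- `S_w(λ; x/e) = c ∫ f`, `𝓜 = c √(2π/φ)`, `A 0 = e^{-α} Ŵ_λ(α)`
  have hS := scaledSum_eq_integral hx0 hα0 y he0 lam
  have hA0 : scaledKernel α e lam 0 = (ρ : ℂ) * twistMellin lam α := by
    simp only [scaledKernel]
    push_cast
    rw [zero_mul, add_zero, hρ, Complex.ofReal_cpow he0'.le]
    push_cast
    rfl
  rw [hA0] at hK
  have hmain : x ^ α * smoothZeta α y / Real.sqrt (2 * Real.pi * φ) = c * Real.sqrt (2 * Real.pi / φ) := by
    rw [hc, SaddleKernel.main_const_identity hφ0]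
  rw [hmain, hS]
  have halg : (c : ℂ) * (∫ t, scaledIntegrand x α y e lam t) -
      (((ρ * (c * Real.sqrt (2 * Real.pi / φ)) : ℝ)) : ℂ) * twistMellin lam α =
      (c : ℂ) * ((∫ t, SaddleKernel.kernelIntegrand x α y (scaledKernel α e lam) t) -
        (ρ : ℂ) * twistMellin lam α * (Real.sqrt (2 * Real.pi / φ) : ℂ)) := by
    simp only [scaledIntegrand]
    push_cast; ring
  rw [halg, norm_mul, Complex.norm_real, Real.norm_eq_abs, abs_of_pos hc0]
  rw [show ∀ B : ℝ, c * ρ * B = c * (ρ * B) from fun B => mul_assoc _ _ _]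
  apply mul_le_mul_of_nonneg_left (hK.trans _) hc0.le
  -- compare the two error expressions
  have hw0n : ‖(ρ : ℂ) * twistMellin lam α‖ ≤ b₀ := by
    have := hB0 0 (by norm_num); rwa [hA0] at this
  have hgpos : 0 ≤ Real.exp (-(φ / 4) * (100 / Real.sqrt φ) ^ 2) * Real.sqrt (4 * Real.pi / φ) := by positivity
  have hl : 0 < 1 + |lam| := by positivity
  have h1 : (1475 * b₀ * Real.log y + 4 * b₁) / φ = ρ * ((2950 * Real.log y + 8 + 8 * Real.log e) / (φ * (1 + |lam|))) := by
    rw [hb₀, hb₁]; field_simp; ring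
  have h2 : ‖(ρ : ℂ) * twistMellin lam α‖ * (Real.exp (-(φ / 4) * (100 / Real.sqrt φ) ^ 2) * Real.sqrt (4 * Real.pi / φ)) ≤
      ρ * (2 / (1 + |lam|) * (Real.exp (-(φ / 4) * (100 / Real.sqrt φ) ^ 2) * Real.sqrt (4 * Real.pi / φ))) := by
    calc _ ≤ b₀ * (Real.exp (-(φ / 4) * (100 / Real.sqrt φ) ^ 2) * Real.sqrt (4 * Real.pi / φ)) :=
          mul_le_mul_of_nonneg_right hw0n hgpos
      _ = _ := by rw [hb₀]; ring
  have h3 : b₀ * Real.exp (-72) * Real.sqrt (125 * Real.pi ^ 3 / φ) + 10 * Real.pi * ε₁ * b₀ / α +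
      2 * Real.pi * ε₂ * ρ * T + 2 * Real.pi * (ρ * Cl) / T ^ 2 =
      ρ * (2 / (1 + |lam|) * Real.exp (-72) * Real.sqrt (125 * Real.pi ^ 3 / φ) +
        20 * Real.pi * ε₁ / (α * (1 + |lam|)) + 2 * Real.pi * ε₂ * T + 2 * Real.pi * Cl / T ^ 2) := by
    rw [hb₀]; field_simp; ring
  rw [h1, h3]
  nlinarith [h2, hρ0]

end TwistedWeight

end Literature.NumberTheory.Sieve

end
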